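import Literature.Computability.QuantumComplexity.CliffordTInverse
import Literature.Computability.Cryptography.QuantumCircuitDescFP
import HarnessLib

/-!
# The description of the inverse of a Clifford+T circuit

The inverse circuit `QCircuit.inv C` of `CliffordTInverse.lean` (gates in reverse order, each
replaced by `invReps` verbatim copies of itself: `H ↦ H`, `S ↦ S³`, `T ↦ T⁷`, `CNOT ↦ CNOT`,
oracle gates once) has a description (`QCircuit.encode`: the right-nested pair list of the
gate codes `QGate.encode`, `QuantumCircuitDescFP.encode_eq_encList`) which is an elementary
transformation of the description of `C`: **reverse the list of gate codes and repeat each code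
according to its gate symbol**, read off the code itself (`invRepsOfCode`: the symbol numeral
behind the tag bit is `bin 1` for `S`, `bin 2` for `T`). This is the string-level form needed
for the uniformity of families containing inverses of the circuits of a given uniform family
(classical wrapping of a quantum subroutine; Bernstein–Vazirani 1997, §8):

* `invRepsOfCode`, `invRepsOfCode_encode_gate`, `invRepsOfCode_encode_oracle`;
* `invCodeItems items = items.reverse.flatMap (a ↦ replicate (invRepsOfCode a) a)`;
* **`encode_inv`**: `C.inv.encode = encList (invCodeItems (C.gates.map QGate.encode))`.

## References

* E. Bernstein, U. Vazirani, *Quantum complexity theory*, SIAM J. Comput. 26 (1997), §8.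
* S. Arora, B. Barak, *Computational Complexity: A Modern Approach*, CUP 2009, §6.1 (circuit
  descriptions), Remark 6.7.
* M. A. Nielsen, I. L. Chuang, *Quantum Computation and Quantum Information*, CUP 2010, §4.2.
-/

noncomputable section

namespace Literature.Computability.QuantumComplexity

open _root_.Computability Complexity Cryptography

variable {N : ℕ}

/-! ### The repetition count read off a gate code -/

/-- The symbol numeral of a gate code: the first pair component behind the tag bit. [folklore] -/
def symbolOfCode (a : List Bool) : List Bool := (boolUnpair a.tail).1

/-- **The repetition count of a gate code**: `3` if its symbol numeral is `bin 1` (the gate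
`S`), `7` if it is `bin 2` (the gate `T`), `1` otherwise (`H`, `CNOT`, oracle gates).
[cite: NielsenChuang2010, §4.2 p. 174] -/
def invRepsOfCode (a : List Bool) : ℕ :=
  if symbolOfCode a = [true] then 3 else if symbolOfCode a = [false, true] then 7 else 1

/-- The symbol numeral of the code of a placed gate symbol is the binary code of the symbol.
[folklore] -/
theorem symbolOfCode_encode_gate {G : QGateSet} [Encodable G.Op] (g : G.Op) (e : Fin (G.arity g) ↪ Fin N) :
    symbolOfCode (QGate.gate g e : QGate G N).encode = encodeNat (Encodable.encode g) := by
  simp [symbolOfCode, QGate.encode]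

/-- The symbol numeral of the code of an oracle gate is the binary numeral of its query width.
[folklore] -/
theorem symbolOfCode_encode_oracle {G : QGateSet} [Encodable G.Op] (k : ℕ) (e : Fin (k + 1) ↪ Fin N) :
    symbolOfCode (QGate.oracle k e : QGate G N).encode = encodeNat k := by
  simp [symbolOfCode, QGate.encode]

/-- The codes of the Clifford+T symbols: `H ↦ 0`, `S ↦ 1`, `T ↦ 2`, `CNOT ↦ 3`. [folklore] -/
theorem encode_cliffordTOp (g : CliffordTOp) :
    Encodable.encode g = (match g with | .H => 0 | .S => 1 | .T => 2 | .CNOT => 3 : ℕ) := by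
  cases g <;> rfl

/-- `bin 1 = [1]`. [folklore] -/
theorem encodeNat_one : encodeNat 1 = [true] := by decide
/-- `bin 2 = [0, 1]`. [folklore] -/
theorem encodeNat_two : encodeNat 2 = [false, true] := by decide
/-- `bin 0 = []`. [folklore] -/
theorem encodeNat_zero : encodeNat 0 = [] := by decide
/-- `bin 3 = [1, 1]`. [folklore] -/
theorem encodeNat_three : encodeNat 3 = [true, true] := by decide

/-- **The repetition count of the code of a Clifford+T gate is `invReps`.** [cite: NielsenChuang2010, §4.2 p. 174] -/
theorem invRepsOfCode_encode_gate (g : CliffordTOp) (e : Fin (cliffordT.arity g) ↪ Fin N) :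
    invRepsOfCode (QGate.gate g e : QGate cliffordT N).encode = invReps g := by
  rw [invRepsOfCode, symbolOfCode_encode_gate]
  change (if encodeNat (Encodable.encode (g : CliffordTOp)) = [true] then 3
    else if encodeNat (Encodable.encode (g : CliffordTOp)) = [false, true] then 7 else 1) = invReps g
  rw [encode_cliffordTOp]
  cases g
  · rw [encodeNat_zero]; rfl
  · rw [encodeNat_one]; rfl
  · rw [encodeNat_two, if_neg (by decide)]; rfl
  · rw [encodeNat_three, if_neg (by decide), if_neg (by decide)]; rfl

/-- An oracle gate code has repetition count `1` unless its width numeral collides with the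
codes of `S`/`T` — which the inverse word does not use: we only need the count on the codes
actually produced, see `map_encode_invWord`. For widths `k ≠ 1, 2` it is `1`. [folklore] -/
theorem invRepsOfCode_encode_oracle {k : ℕ} (hk1 : k ≠ 1) (hk2 : k ≠ 2) (e : Fin (k + 1) ↪ Fin N) :
    invRepsOfCode (QGate.oracle k e : QGate cliffordT N).encode = 1 := by
  rw [invRepsOfCode, symbolOfCode_encode_oracle]
  have h1 : encodeNat k ≠ [true] := fun h => hk1 (by
    have h' := congrArg decodeNat h; rw [decode_encodeNat, ← encodeNat_one, decode_encodeNat] at h'; exact h')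
  have h2 : encodeNat k ≠ [false, true] := fun h => hk2 (by
    have h' := congrArg decodeNat h; rw [decode_encodeNat, ← encodeNat_two, decode_encodeNat] at h'; exact h')
  rw [if_neg h1, if_neg h2]

/-! ### The transformation of the code list -/

/-- **The inverse-code transformation of a list of gate codes**: reverse, and repeat each code
by its repetition count. [cite: NielsenChuang2010, §3.2.5 p. 158] -/
def invCodeItems (items : List (List Bool)) : List (List Bool) :=
  items.reverse.flatMap fun a => List.replicate (invRepsOfCode a) a

/-- `invCodeItems` of a list extended at the front. [folklore] -/
theorem invCodeItems_cons (a : List Bool) (items : List (List Bool)) :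
    invCodeItems (a :: items) = invCodeItems items ++ List.replicate (invRepsOfCode a) a := by
  simp [invCodeItems, List.flatMap_append]

/-- `invCodeItems [] = []`. [folklore] -/
@[simp] theorem invCodeItems_nil : invCodeItems [] = [] := rfl

/-- The codes of the inverse word of an *oracle-free* gate: `invRepsOfCode` copies of its code.
[folklore] -/
theorem map_encode_invWord {g : QGate cliffordT N} (hg : g.IsOracleFree) :
    g.invWord.map QGate.encode = List.replicate (invRepsOfCode g.encode) g.encode := by
  cases g with
  | gate g e => rw [QGate.invWord_gate, List.map_replicate, invRepsOfCode_encode_gate]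
  | oracle k e => exact absurd hg id

/-- **The description of the inverse of an oracle-free Clifford+T circuit** is the pair list of
the inverse-code transformation of its gate codes. [cite: NielsenChuang2010, §3.2.5 p. 158] -/
theorem encode_inv {C : QCircuit cliffordT N} (hC : C.IsOracleFree) :
    C.inv.encode = encList (invCodeItems (C.gates.map QGate.encode)) := by
  rw [QCircuit.encode_eq_encList, QCircuit.gates_inv]
  congr 1
  obtain ⟨gs⟩ := C
  change ∀ g ∈ gs, g.IsOracleFree at hC
  induction gs with
  | nil => rfl
  | cons g gs ih =>
    have hg : g.IsOracleFree := hC g (by simp)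
    have hgs : ∀ g' ∈ gs, g'.IsOracleFree := fun g' hg' => hC g' (by simp [hg'])
    rw [List.reverse_cons, List.flatMap_append, List.map_append, List.flatMap_singleton, ih hgs, List.map_cons,
      invCodeItems_cons, map_encode_invWord hg]

/-- The number of codes of the inverse: at most `7` per gate. [folklore] -/
theorem length_invCodeItems_le (items : List (List Bool)) : (invCodeItems items).length ≤ 7 * items.length := by
  induction items with
  | nil => simp
  | cons a items ih =>
    rw [invCodeItems_cons, List.length_append, List.length_replicate, List.length_cons]
    have : invRepsOfCode a ≤ 7 := by unfold invRepsOfCode; split_ifs <;> omega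
    omega

/-- Every code of the inverse is a code of the original list. [folklore] -/
theorem mem_of_mem_invCodeItems {items : List (List Bool)} {a : List Bool} (h : a ∈ invCodeItems items) : a ∈ items := by
  simp only [invCodeItems, List.mem_flatMap, List.mem_reverse, List.mem_replicate] at h
  obtain ⟨b, hb, -, rfl⟩ := h
  exact hb

end Literature.Computability.QuantumComplexity
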